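import Summits.Schanuel.Schanuel.Theorems.ZilberEacComplexRealHyperplane
import Summits.Schanuel.Schanuel.Theorems.ZilberEacComplexMovingPolydiscLocal
import Literature.ModelTheory.Zilber.EACDensityQuestion
import HarnessLib

/-!
# EC over real hyperplane bases in the SLOW-GROWTH regime (`0 ≤ λ < dⱼ`)

Zilber's Exponential-Algebraic Closedness, case ladder (host summit Schanuel, cell `pub-schanuel`,
seat 2, gen 7).  Theorem R (`ZilberEacComplexRealHyperplane.exists_expPoint_realHyperplane`) solves
`e^{xⱼ} = Aⱼ(x') + e^{ℓ(x)} Fⱼ(e^{ℓ(x)})`, `ℓ(x) = Σ rᵢ xᵢ + c` (`rᵢ ∈ ℝ`), near the lattice centres when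
`λ := Σ rⱼ deg Aⱼ < 0`, i.e. when the coordinate `y_{s+1} = e^{ℓ}` tends to the puncture.  This file
removes the sign condition as far as the contraction allows:

**THEOREM R⁺ (`exists_expPoint_realHyperplane_slow`).**  Same data; assume instead
`λ + max(λ, 0) · deg Fⱼ < deg Aⱼ` for every `j`.  Then for all large `m` the system has a solution
within `1/2` of the lattice centre `x₀(m) = (2πi m qⱼ + log Aⱼ(2πi m q))ⱼ`.  For `λ < 0` this is
Theorem R; NEW is the slow-growth regime `0 ≤ λ(1 + deg Fⱼ) < deg Aⱼ`, where `|y_{s+1}| ≍ m^{λ}` GROWS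
but the perturbation `e^{ℓ} Fⱼ(e^{ℓ}) = O(m^{λ(1 + deg Fⱼ)})` stays `o(|Aⱼ|) = o(m^{deg Aⱼ})`; the input
is the relative-smallness form of the moving-polydisc theorem
(`ZilberEacComplexMovingPolydiscLocal.exists_exp_eq_poly_add_near_latticeCentre_local`).
Examples: `n = 2`, `{x₁ = a x₀ + b, y₀ = A(x₀) + c y₁}` with ANY real `a < 1` (`deg A ≥ 1`): the
equation `e^{z} = A(z) + c e^{a z + b}` is solvable (`exists_exp_eq_poly_add_exp_line`; e.g.
`e^{z} = z + e^{z/2}`); `(3,2)`: `e^{z} = z + e^{(z+w)/3}`, `e^{w} = w + e^{(z+w)/3}`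
(`slow_growth_model_system_solvable`, `λ = 2/3 < 1`; base the RATIONAL plane `3x₃ = x₁ + x₂`, so this
member is not additively free — the theorem does not need freeness; free members: `rᵢ` irrational with
`Σ rᵢ < 1`, e.g. `x₃ = (√2/4)(x₁ + x₂)`, `sqrt_two_quarter_model_system_solvable`).

HONEST FRAMING: a modest extension of a problem-side existence theorem to a new regime; explicit
families; nothing here bears on Schanuel's conjecture; `ECCell 3 2` OPEN.
-/

noncomputable section

open Complex MvPolynomial Metric Set Filter Topology
open Literature.ModelTheory.Zilber

set_option linter.dupNamespace false

namespace Summit.Schanuel.Schanuel.Theorems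

/-- **THEOREM R⁺ (real hyperplane base, slow-growth regime).**  Let `q ∈ ℤˢ`, `v = 2πi q`, `r ∈ ℝˢ`,
`c ∈ ℂ`, `Aⱼ ∈ ℂ[x₁..xₛ]` with `(Aⱼ)_{dⱼ}(v) ≠ 0`, `Fⱼ ∈ ℂ[u]`, `λ := Σⱼ rⱼ dⱼ`, and assume
`λ + max(λ,0) deg Fⱼ < dⱼ` for all `j`.  Then for all large `m` there is `x` within `1/2` of the
lattice centre with `exp xⱼ = Aⱼ(x) + e^{ℓ(x)} Fⱼ(e^{ℓ(x)})`, `ℓ(x) = Σᵢ rᵢ xᵢ + c`. -/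
theorem exists_expPoint_realHyperplane_slow {s : ℕ} (r : Fin s → ℝ) (c : ℂ) (q : Fin s → ℤ)
    (A : Fin s → MvPolynomial (Fin s) ℂ)
    (hA : ∀ j, eval (fun i => 2 * Real.pi * I * (q i : ℂ))
      (homogeneousComponent (A j).totalDegree (A j)) ≠ 0)
    (F : Fin s → Polynomial ℂ)
    (hlam : ∀ j, (∑ i, r i * (A i).totalDegree) +
      max (∑ i, r i * (A i).totalDegree) 0 * ((F j).natDegree : ℝ) < (A j).totalDegree) :
    ∀ᶠ m : ℕ in atTop, ∃ x : Fin s → ℂ,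
      ‖x - fun i => (m : ℂ) * (2 * Real.pi * I * (q i : ℂ)) +
          log (eval (fun k => (m : ℂ) * (2 * Real.pi * I * (q k : ℂ))) (A i))‖ ≤ 1 / 2 ∧
      ∀ j, exp (x j) = eval x (A j) +
        exp (∑ i, (r i : ℂ) * x i + c) * (F j).eval (exp (∑ i, (r i : ℂ) * x i + c)) := by
  classical
  set v : Fin s → ℂ := fun j => 2 * Real.pi * I * (q j : ℂ) with hv
  set x₀ : ℕ → Fin s → ℂ := fun m i => (m : ℂ) * v i +
    log (eval (fun k => (m : ℂ) * v k) (A i)) with hx₀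
  set lam : ℝ := ∑ j, r j * (A j).totalDegree with hlamdef
  -- the perturbation
  set ℓ : (Fin s → ℂ) → ℂ := fun x => ∑ i, (r i : ℂ) * x i + c with hℓ
  set P : Fin s → (Fin s → ℂ) → ℂ := fun j x => exp (ℓ x) * (F j).eval (exp (ℓ x)) with hP
  have hℓdiff : Differentiable ℂ ℓ := by
    refine (Differentiable.fun_sum fun i _ => ?_).add_const _
    exact (differentiable_apply i).const_mul _
  have hPdiff : ∀ j, Differentiable ℂ (P j) := fun j =>
    hℓdiff.cexp.mul ((F j).differentiable.comp hℓdiff.cexp)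
  -- lattice values: two-sided log bounds, eventually
  set a : Fin s → ℝ := fun j => ‖eval v (homogeneousComponent (A j).totalDegree (A j))‖ with ha
  have ha0 : ∀ j, 0 < a j := fun j => norm_pos_iff.mpr (hA j)
  have hctrl := fun j => latticeValue_control (A j) v (hA j) one_pos
  choose ρ hρ t₀ ht₀ hc using hctrl
  -- the constant absorbing the `O(1)` terms
  set C₀ : ℝ := ‖c‖ + ∑ j, |r j| * (|Real.log (a j / 2)| + |Real.log (2 * a j)| + 1) with hC₀
  have hC₀c : ‖c‖ ≤ C₀ := by
    rw [hC₀]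
    have : 0 ≤ ∑ j, |r j| * (|Real.log (a j / 2)| + |Real.log (2 * a j)| + 1) :=
      Finset.sum_nonneg fun j _ => by positivity
    linarith
  -- ### the key estimate: `Re ℓ ≤ λ log m + C₀` on the unit polydisc around `x₀ m`
  have hkey : ∀ᶠ m : ℕ in atTop, ∀ ξ : Fin s → ℂ, ‖ξ‖ ≤ 1 →
      (ℓ (x₀ m + ξ)).re ≤ lam * Real.log m + C₀ := by
    filter_upwards [eventually_all.2 fun j => tendsto_natCast_atTop_atTop.eventually_ge_atTop (t₀ j)]
      with m hm ξ hξ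
    have hterm : ∀ j, ((r j : ℂ) * (x₀ m j + ξ j)).re ≤
        r j * (A j).totalDegree * Real.log m +
          |r j| * (|Real.log (a j / 2)| + |Real.log (2 * a j)| + 1) := by
      intro j
      obtain ⟨hne, hlow, hupp, -⟩ := hc j m (hm j)
      have hm1 : (1 : ℝ) ≤ m := (ht₀ j).trans (hm j)
      obtain ⟨h1, h2, -⟩ := log_latticeValue_bounds (by have := ha0 j; positivity) hm1 hlow hupp
      have hre : (x₀ m j + ξ j).re = Real.log ‖eval (fun k => (m : ℂ) * v k) (A j)‖ + (ξ j).re := by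
        simp only [hx₀, Complex.add_re, Complex.log_re, Complex.mul_re, Complex.natCast_re,
          Complex.natCast_im, zero_mul, sub_zero]
        have : (v j).re = 0 := by simp [hv]
        rw [this, mul_zero, zero_add]
      rw [Complex.re_ofReal_mul, hre]
      have h3 : |(ξ j).re| ≤ 1 := (Complex.abs_re_le_norm _).trans ((norm_le_pi_norm ξ j).trans hξ)
      rw [abs_le] at h3
      obtain ⟨h3a, h3b⟩ := h3
      -- `t := log ‖α‖ + Re ξ - d log m` lies in `[log(a/2) - 1, log(2a) + 1]`
      set t : ℝ := Real.log ‖eval (fun k => (m : ℂ) * v k) (A j)‖ + (ξ j).re -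
        (A j).totalDegree * Real.log m with ht
      have ht1 : |t| ≤ |Real.log (a j / 2)| + |Real.log (2 * a j)| + 1 := by
        rw [abs_le]
        constructor
        · have := neg_abs_le (Real.log (a j / 2))
          have := abs_nonneg (Real.log (2 * a j))
          rw [ht]; linarith
        · have := le_abs_self (Real.log (2 * a j))
          have := abs_nonneg (Real.log (a j / 2))
          rw [ht]; linarith
      have hsplit : r j * (Real.log ‖eval (fun k => (m : ℂ) * v k) (A j)‖ + (ξ j).re) =
          r j * (A j).totalDegree * Real.log m + r j * t := by rw [ht]; ring
      rw [hsplit]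
      have h4 : r j * t ≤ |r j| * (|Real.log (a j / 2)| + |Real.log (2 * a j)| + 1) := by
        calc r j * t ≤ |r j * t| := le_abs_self _
          _ = |r j| * |t| := abs_mul _ _
          _ ≤ |r j| * (|Real.log (a j / 2)| + |Real.log (2 * a j)| + 1) :=
              mul_le_mul_of_nonneg_left ht1 (abs_nonneg _)
      linarith
    have hℓre : (ℓ (x₀ m + ξ)).re = ∑ i, ((r i : ℂ) * (x₀ m i + ξ i)).re + c.re := by
      simp only [hℓ, Complex.add_re, Complex.re_sum, Pi.add_apply]
    rw [hℓre]
    have hsum := Finset.sum_le_sum fun j (_ : j ∈ Finset.univ) => hterm j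
    rw [Finset.sum_add_distrib, ← Finset.sum_mul] at hsum
    have hc' : c.re ≤ ‖c‖ := Complex.re_le_norm c
    rw [hC₀, hlamdef]
    linarith
  -- ### relative smallness of the perturbation: `‖P_j‖ ≤ K_j m^{μ_j}`, `μ_j < d_j`
  set B : Fin s → ℝ := fun j => ∑ i ∈ Finset.range ((F j).natDegree + 1), ‖(F j).coeff i‖ with hB
  have hB0 : ∀ j, 0 ≤ B j := fun j => Finset.sum_nonneg fun i _ => norm_nonneg _
  set μ : Fin s → ℝ := fun j => lam + max lam 0 * ((F j).natDegree : ℝ) with hμ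
  have hμlt : ∀ j, μ j < (A j).totalDegree := fun j => hlam j
  set K : Fin s → ℝ := fun j => Real.exp C₀ * (B j * Real.exp |C₀| ^ (F j).natDegree) with hK
  have hPbound : ∀ᶠ m : ℕ in atTop, ∀ j, ∀ ξ : Fin s → ℂ, ‖ξ‖ ≤ 1 →
      ‖P j (x₀ m + ξ)‖ ≤ K j * (m : ℝ) ^ μ j := by
    filter_upwards [hkey, eventually_ge_atTop 1] with m hm hm_one j ξ hξ
    have hm1' : (1 : ℝ) ≤ m := by exact_mod_cast hm_one
    have hm0 : (0 : ℝ) < m := by linarith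
    have hre := hm ξ hξ
    have hexp : ‖exp (ℓ (x₀ m + ξ))‖ ≤ Real.exp C₀ * (m : ℝ) ^ lam := by
      rw [Complex.norm_exp]
      refine (Real.exp_le_exp.mpr hre).trans ?_
      rw [show lam * Real.log m + C₀ = C₀ + lam * Real.log m by ring, Real.exp_add,
        Real.rpow_def_of_pos hm0, mul_comm (Real.log m)]
    -- `max 1 ‖e^ℓ‖ ≤ e^{|C₀|} m^{max λ 0}`
    have hmax : max 1 ‖exp (ℓ (x₀ m + ξ))‖ ≤ Real.exp |C₀| * (m : ℝ) ^ max lam 0 := by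
      have h1 : (1 : ℝ) ≤ Real.exp |C₀| * (m : ℝ) ^ max lam 0 := by
        have ha : (1 : ℝ) ≤ Real.exp |C₀| := Real.one_le_exp (abs_nonneg _)
        have hb : (1 : ℝ) ≤ (m : ℝ) ^ max lam 0 := Real.one_le_rpow hm1' (le_max_right _ _)
        nlinarith
      have h2 : Real.exp C₀ * (m : ℝ) ^ lam ≤ Real.exp |C₀| * (m : ℝ) ^ max lam 0 :=
        mul_le_mul (Real.exp_le_exp.2 (le_abs_self _))
          (Real.rpow_le_rpow_of_exponent_le hm1' (le_max_left _ _))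
          (Real.rpow_nonneg hm0.le _) (Real.exp_pos _).le
      exact max_le h1 (hexp.trans h2)
    have hF : ‖(F j).eval (exp (ℓ (x₀ m + ξ)))‖ ≤
        B j * (Real.exp |C₀| * (m : ℝ) ^ max lam 0) ^ (F j).natDegree :=
      (norm_eval_le_sum_mul_pow (F j) _).trans
        (mul_le_mul_of_nonneg_left (pow_le_pow_left₀ (zero_le_one.trans (le_max_left _ _)) hmax _)
          (hB0 j))
    calc ‖P j (x₀ m + ξ)‖
        = ‖exp (ℓ (x₀ m + ξ))‖ * ‖(F j).eval (exp (ℓ (x₀ m + ξ)))‖ := norm_mul _ _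
      _ ≤ (Real.exp C₀ * (m : ℝ) ^ lam) *
          (B j * (Real.exp |C₀| * (m : ℝ) ^ max lam 0) ^ (F j).natDegree) :=
          mul_le_mul hexp hF (norm_nonneg _) (by positivity)
      _ = K j * ((m : ℝ) ^ lam * ((m : ℝ) ^ max lam 0) ^ (F j).natDegree) := by
          rw [hK, mul_pow]; ring
      _ = K j * (m : ℝ) ^ μ j := by
          rw [hμ, ← Real.rpow_natCast, ← Real.rpow_mul hm0.le, Real.rpow_add hm0]
  have hPsmall : ∀ j, ∀ θ : ℝ, 0 < θ → ∀ᶠ m : ℕ in atTop, ∀ ξ : Fin s → ℂ, ‖ξ‖ < 1 →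
      ‖P j (x₀ m + ξ)‖ ≤ θ * (m : ℝ) ^ (A j).totalDegree := by
    intro j θ hθ
    have hK0 : 0 ≤ K j := by positivity
    -- `K m^{μ} ≤ θ m^{d}` eventually since `μ < d`
    have hev : ∀ᶠ m : ℕ in atTop, K j * (m : ℝ) ^ μ j ≤ θ * (m : ℝ) ^ ((A j).totalDegree : ℝ) := by
      have hgap : 0 < ((A j).totalDegree : ℝ) - μ j := by linarith [hμlt j]
      have h1 : Tendsto (fun m : ℕ => (m : ℝ) ^ (((A j).totalDegree : ℝ) - μ j)) atTop atTop :=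
        (tendsto_rpow_atTop hgap).comp tendsto_natCast_atTop_atTop
      filter_upwards [h1.eventually_ge_atTop (K j / θ), eventually_ge_atTop 1] with m hm hm_one
      have hm0 : (0 : ℝ) < m := by exact_mod_cast hm_one
      have h2 : K j ≤ θ * (m : ℝ) ^ (((A j).totalDegree : ℝ) - μ j) := by
        rw [div_le_iff₀ hθ] at hm
        linarith [hm]
      calc K j * (m : ℝ) ^ μ j ≤ θ * (m : ℝ) ^ (((A j).totalDegree : ℝ) - μ j) * (m : ℝ) ^ μ j :=
            mul_le_mul_of_nonneg_right h2 (Real.rpow_nonneg hm0.le _)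
        _ = θ * (m : ℝ) ^ ((A j).totalDegree : ℝ) := by
            rw [mul_assoc, ← Real.rpow_add hm0, sub_add_cancel]
    filter_upwards [hPbound, hev] with m hm hmθ ξ hξ
    have h := hm j ξ hξ.le
    rw [← Real.rpow_natCast]
    exact h.trans hmθ
  exact exists_exp_eq_poly_add_near_latticeCentre_local q A hA (fun _ => P)
    (Eventually.of_forall fun m j => (hPdiff j).differentiableOn) hPsmall


/-- **`n = 2`: the moving target `z` over a real line of slope `a < 1`.**  For every real `a < 1` and
`b, c ∈ ℂ` the equation `e^{z} = z + c e^{a z + b}` has a solution — an exponential point of the surface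
`{x₁ = a x₀ + b, y₀ = x₀ + c y₁}` (`λ = a`; for `0 ≤ a < 1` outside Theorem R). -/
theorem exists_exp_eq_self_add_exp_line {a : ℝ} (ha : a < 1) (b c : ℂ) :
    ∃ z : ℂ, exp z = z + c * exp ((a : ℂ) * z + b) := by
  set q : Fin 1 → ℤ := ![1] with hq
  set A : Fin 1 → MvPolynomial (Fin 1) ℂ := ![X 0] with hAdef
  have hA0 : A 0 = X 0 := by simp [hAdef]
  have hdegA0 : (A 0).totalDegree = 1 := by rw [hA0, totalDegree_X]
  have hpi : (2 * (Real.pi : ℂ) * I) ≠ 0 := by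
    have := Real.pi_pos
    simp [Complex.ext_iff, this.ne']
  have hA : ∀ j, eval (fun i : Fin 1 => 2 * Real.pi * I * ((q i : ℤ) : ℂ))
      (homogeneousComponent (A j).totalDegree (A j)) ≠ 0 := by
    intro j
    fin_cases j
    show eval _ (homogeneousComponent (A 0).totalDegree (A 0)) ≠ 0
    rw [hdegA0, hA0, homogeneousComponent_eq_self (isHomogeneous_X ℂ 0), eval_X]
    simp [hq, hpi]
  set r : Fin 1 → ℝ := ![a] with hr
  have hlam : ∀ j : Fin 1, (∑ i, r i * (A i).totalDegree) +
      max (∑ i, r i * (A i).totalDegree) 0 * (((fun _ => Polynomial.C c : Fin 1 → Polynomial ℂ) j).natDegree : ℝ)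
        < (A j).totalDegree := by
    intro j
    fin_cases j
    show (∑ i, r i * (A i).totalDegree) + max (∑ i, r i * (A i).totalDegree) 0 *
      ((Polynomial.C c).natDegree : ℝ) < (A 0).totalDegree
    rw [Fin.sum_univ_one, hdegA0, Polynomial.natDegree_C]
    simp only [hr, Matrix.cons_val_fin_one, Nat.cast_one, mul_one, Nat.cast_zero, mul_zero, add_zero]
    exact ha
  obtain ⟨m, x, -, hx⟩ := (exists_expPoint_realHyperplane_slow r b q A hA
    (fun _ => Polynomial.C c) hlam).exists
  refine ⟨x 0, ?_⟩
  have h := hx 0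
  rw [hA0, eval_X, Polynomial.eval_C, Fin.sum_univ_one] at h
  simp only [hr, Matrix.cons_val_fin_one] at h
  rw [h]
  ring

/-- **A member of the APERIODIC piece of `EC(3,2)` in the slow-growth regime**:
`∃ z w, e^{z} = z + e^{(√2 z + √3 w)/4} ∧ e^{w} = w + e^{(√2 z + √3 w)/4}` — base the plane
`x₃ = (√2/4) x₁ + (√3/4) x₂` (`1, √2/4, √3/4` are `ℚ`-independent), fibres `yⱼ = xⱼ + y₃`,
`λ = (√2 + √3)/4 ∈ (0, 1)`: `|y₃| ≍ m^{λ}` grows, outside Theorem R. -/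
theorem slow_growth_model_system_solvable :
    ∃ z w : ℂ, exp z = z + exp ((Real.sqrt 2 / 4 : ℝ) * z + (Real.sqrt 3 / 4 : ℝ) * w) ∧
      exp w = w + exp ((Real.sqrt 2 / 4 : ℝ) * z + (Real.sqrt 3 / 4 : ℝ) * w) := by
  set q : Fin 2 → ℤ := ![1, 1] with hq
  have hv : (fun j : Fin 2 => 2 * (Real.pi : ℂ) * I * ((q j : ℤ) : ℂ)) = fun _ => 2 * Real.pi * I := by
    funext j; fin_cases j <;> simp [hq]
  set A : Fin 2 → MvPolynomial (Fin 2) ℂ := ![X 0, X 1] with hAdef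
  have hA0 : A 0 = X 0 := by simp [hAdef]
  have hA1 : A 1 = X 1 := by simp [hAdef]
  have hdegA0 : (A 0).totalDegree = 1 := by rw [hA0, totalDegree_X]
  have hdegA1 : (A 1).totalDegree = 1 := by rw [hA1, totalDegree_X]
  have hpi : (2 * (Real.pi : ℂ) * I) ≠ 0 := by
    have := Real.pi_pos
    simp [Complex.ext_iff, this.ne']
  have hA : ∀ j, eval (fun i : Fin 2 => 2 * Real.pi * I * ((q i : ℤ) : ℂ))
      (homogeneousComponent (A j).totalDegree (A j)) ≠ 0 := by
    rw [hv]
    refine Fin.forall_fin_two.mpr ⟨?_, ?_⟩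
    · rw [hdegA0, hA0, homogeneousComponent_eq_self (isHomogeneous_X ℂ 0), eval_X]; exact hpi
    · rw [hdegA1, hA1, homogeneousComponent_eq_self (isHomogeneous_X ℂ 1), eval_X]; exact hpi
  set r : Fin 2 → ℝ := ![Real.sqrt 2 / 4, Real.sqrt 3 / 4] with hr
  have h2 : Real.sqrt 2 < 3 / 2 := by
    rw [Real.sqrt_lt' (by norm_num)]; norm_num
  have h3 : Real.sqrt 3 < 9 / 5 := by
    rw [Real.sqrt_lt' (by norm_num)]; norm_num
  have hlam : ∀ j : Fin 2, (∑ i, r i * (A i).totalDegree) +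
      max (∑ i, r i * (A i).totalDegree) 0 *
        (((fun _ => Polynomial.C 1 : Fin 2 → Polynomial ℂ) j).natDegree : ℝ) <
        (A j).totalDegree := by
    have hsum : (∑ i, r i * (A i).totalDegree) = Real.sqrt 2 / 4 + Real.sqrt 3 / 4 := by
      rw [Fin.sum_univ_two, hdegA0, hdegA1]
      simp only [hr, Matrix.cons_val_zero, Matrix.cons_val_one]
      push_cast
      ring
    have hdegA : ∀ j, ((A j).totalDegree : ℝ) = 1 :=
      Fin.forall_fin_two.mpr ⟨by rw [hdegA0]; norm_num, by rw [hdegA1]; norm_num⟩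
    intro j
    rw [hsum, hdegA j]
    simp only [Polynomial.natDegree_C, Nat.cast_zero, mul_zero, add_zero]
    linarith
  obtain ⟨m, x, -, hx⟩ := (exists_expPoint_realHyperplane_slow r 0 q A hA
    (fun _ => Polynomial.C 1) hlam).exists
  have hℓ : ∑ i, ((r i : ℝ) : ℂ) * x i + 0 =
      (Real.sqrt 2 / 4 : ℝ) * x 0 + (Real.sqrt 3 / 4 : ℝ) * x 1 := by
    rw [Fin.sum_univ_two]
    simp only [hr, Matrix.cons_val_zero, Matrix.cons_val_one, add_zero]
  refine ⟨x 0, x 1, ?_, ?_⟩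
  · have h := hx 0
    rw [hA0, eval_X, hℓ, Polynomial.eval_C, mul_one] at h
    exact h
  · have h := hx 1
    rw [hA1, eval_X, hℓ, Polynomial.eval_C, mul_one] at h
    exact h

end Summit.Schanuel.Schanuel.Theorems

end
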